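import Summits.ValiantsHypothesis.ValiantsHypothesis.Theorems.SliceSignRankSrkNotQPForsterSliceIsotropyConstant

/-!
# Route SliceSignRank — crux `SrkNotQP` (stmt-ValiantsHypothesis-20857), line `forster_slice`:
# the Leibniz representation is `1`-isotropic and Forster's slice inequality is an equality there

Non-vacuity and sharpness of the isotropic surrogate (`forsterSlice_of_isotropyConstant`, p582926)
for EVERY `n`: the Leibniz representation of `sgn` on `S_n` — `k = n!` terms, one signed permutation
matrix `L_τ` per `τ ∈ S_n` (`L_τ(a, i) = [a = τ i] · c_i`, `c_0 = sgn τ`, `c_i = 1` otherwise), so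
that `φ_{L_τ} = sgn(τ) · δ_τ` and `F = Σ_τ φ_{L_τ} = sgn` — satisfies the isotropy-constant hypothesis
with `K = 1` (with equality: `n! · Σ_τ per(L_τ ∘ L_τ) = n! · n! = (Σ_σ |F(σ)|)²`), every term has
`det L_τ = 1 ≠ 0`, and the conclusion `n! · per(L_τ ∘ L_τ) ≤ K · k · det(L_τ)²` holds with EQUALITY
(`n! · 1 = 1 · n! · 1`).  So the constant in the isotropic Forster-slice inequality cannot be
improved uniformly, and its hypotheses are met at every `n` (by a representation of factorial
length — consistent with, and far from, the open question whether SHORT representations can be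
isotropic; see `Cruxes/SrkNotQP/IsotropyCensusP2.md`).  Calibration only; `SrkNotQP`,
`SignRankSuperQP`, `stub_forsterSlice` remain OPEN; `VP ≠ VNP` is not touched.
-/

-- Sub = Summit layout duplicates the namespace component
set_option linter.dupNamespace false

namespace Summit.ValiantsHypothesis.ValiantsHypothesis.Theorems.SliceSignRank.SrkNotQP

open Finset Equiv

/-! ## §1 The signed permutation matrices and their monomial functions -/

/-- The column weights of the Leibniz twist multiply to `s` (`c_0 = s`, `c_i = 1` for `i ≠ 0`;
empty product `1` when `n = 0`). [this file] -/
theorem prod_ite_val_eq_zero (n : ℕ) (s : ℝ) :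
    (∏ i : Fin n, (if (i : ℕ) = 0 then s else 1)) = if n = 0 then 1 else s := by
  rcases Nat.eq_zero_or_pos n with rfl | hn
  · simp
  · obtain ⟨m, rfl⟩ := Nat.exists_eq_succ_of_ne_zero hn.ne'
    rw [Fin.prod_univ_succ]
    simp

/-- **Monomial function of a signed permutation matrix**: for
`L(a, i) = [a = τ i] · (if i = 0 then s else 1)`,
`Π_i L(σ i, i) = [σ = τ] · (if n = 0 then 1 else s)`. [this file] -/
theorem prod_signedPerm_apply (n : ℕ) (τ σ : Perm (Fin n)) (s : ℝ) :
    (∏ i : Fin n, (if σ i = τ i then (if (i : ℕ) = 0 then s else (1 : ℝ)) else 0)) =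
      if σ = τ then (if n = 0 then 1 else s) else 0 := by
  by_cases h : σ = τ
  · subst h
    simp only [if_true]
    exact prod_ite_val_eq_zero n s
  · rw [if_neg h]
    obtain ⟨i, hi⟩ : ∃ i, σ i ≠ τ i := not_forall.mp fun hall => h (Equiv.ext hall)
    exact Finset.prod_eq_zero (Finset.mem_univ i) (if_neg hi)

/-- The Leibniz weight `(if n = 0 then 1 else sgn τ)` equals `sgn τ` for every `n` (on `Fin 0` the
only permutation is `1`, of sign `1`). [this file] -/
theorem leibnizWeight_eq_sign (n : ℕ) (τ : Perm (Fin n)) :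
    (if n = 0 then (1 : ℝ) else ((Perm.sign τ : ℤ) : ℝ)) = ((Perm.sign τ : ℤ) : ℝ) := by
  split_ifs with h
  · subst h
    have : τ = 1 := Subsingleton.elim _ _
    simp [this]
  · rfl

/-! ## §2 The Leibniz representation: sign-representation, isotropy `K = 1`, equality -/

/-- **The Leibniz representation is `1`-isotropic and Forster's slice inequality is an equality on
it.**  For every `n` there are `k = |S_n| = n!` real twists `W_t` (the signed permutation matrices)
such that (i) they sign-represent `sgn` on `S_n`; (ii) the isotropy-constant hypothesis of
`forsterSlice_of_isotropyConstant` holds with `K = 1`, with equality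
`n! · Σ_t per(W_t ∘ W_t) = (Σ_σ |F(σ)|)²`; (iii) every term has `det W_t ≠ 0` and
`n! · per(W_t ∘ W_t) = 1 · k · det(W_t)²` — the conclusion of that theorem with EQUALITY.
[this file] -/
theorem leibniz_signRep_isotropic_tight (n : ℕ) :
    ∃ (k : ℕ) (W : Fin k → Matrix (Fin n) (Fin n) ℝ), k = n.factorial ∧
      (∀ σ : Perm (Fin n), 0 < ((Perm.sign σ : ℤ) : ℝ) * ∑ t, ∏ i, W t (σ i) i) ∧
      (n.factorial : ℝ) * ∑ t, (Matrix.of fun i j => W t i j ^ 2).permanent =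
        1 * (∑ σ : Perm (Fin n), |∑ t, ∏ i, W t (σ i) i|) ^ 2 ∧
      ∀ t, (W t).det ≠ 0 ∧
        (n.factorial : ℝ) * (Matrix.of fun i j => W t i j ^ 2).permanent =
          1 * (k : ℝ) * (W t).det ^ 2 := by
  classical
  -- index the terms by `Fin k`, `k = |S_n|`, through an enumeration `e`
  set k : ℕ := Fintype.card (Perm (Fin n)) with hk
  have hkfac : k = n.factorial := by rw [hk, Fintype.card_perm, Fintype.card_fin]
  let e : Fin k ≃ Perm (Fin n) := (Fintype.equivFin (Perm (Fin n))).symm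
  -- the signed permutation matrix of `τ`
  let L : Perm (Fin n) → Matrix (Fin n) (Fin n) ℝ := fun τ =>
    Matrix.of fun a i => if a = τ i then (if (i : ℕ) = 0 then ((Perm.sign τ : ℤ) : ℝ) else 1)
      else 0
  have hsgn : ∀ τ : Perm (Fin n), ((Perm.sign τ : ℤ) : ℝ) = 1 ∨ ((Perm.sign τ : ℤ) : ℝ) = -1 :=
    fun τ => by rcases Int.units_eq_one_or (Perm.sign τ) with h | h <;> simp [h]
  have hsq : ∀ τ : Perm (Fin n), ((Perm.sign τ : ℤ) : ℝ) * ((Perm.sign τ : ℤ) : ℝ) = 1 :=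
    fun τ => by rcases hsgn τ with h | h <;> rw [h] <;> norm_num
  -- monomial function of `L τ`: `φ_τ(σ) = [σ = τ] · sgn τ`
  have hphi : ∀ τ σ : Perm (Fin n),
      (∏ i, L τ (σ i) i) = if σ = τ then ((Perm.sign τ : ℤ) : ℝ) else 0 := by
    intro τ σ
    have h := prod_signedPerm_apply n τ σ ((Perm.sign τ : ℤ) : ℝ)
    simp only [L, Matrix.of_apply]
    rw [h, leibnizWeight_eq_sign]
  -- the represented function is `sgn`
  have hF : ∀ σ : Perm (Fin n), (∑ t : Fin k, ∏ i, L (e t) (σ i) i) = ((Perm.sign σ : ℤ) : ℝ) := by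
    intro σ
    rw [Equiv.sum_comp e (fun τ => ∏ i, L τ (σ i) i)]
    simp_rw [hphi]
    rw [Finset.sum_ite_eq Finset.univ σ (fun τ => ((Perm.sign τ : ℤ) : ℝ))]
    simp
  -- squared norm and determinant of each term
  have hper : ∀ τ : Perm (Fin n), (Matrix.of fun i j => L τ i j ^ 2).permanent = 1 := by
    intro τ
    rw [← sum_prod_sq_eq_permanent (L τ)]
    simp_rw [hphi]
    simp [apply_ite (fun x : ℝ => x ^ 2), hsq, sq]
  have hdet : ∀ τ : Perm (Fin n), (L τ).det = 1 := by
    intro τ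
    rw [← sum_sign_mul_prod_eq_det (L τ)]
    simp_rw [hphi]
    simp [mul_ite, hsq]
  refine ⟨k, fun t => L (e t), hkfac, ?_, ?_, ?_⟩
  · -- (i) sign-representation: `sgn σ · sgn σ = 1 > 0`
    intro σ
    rw [hF σ, hsq σ]
    exact one_pos
  · -- (ii) `n! · Σ_t per = n! · k · 1 = (n!)² = (Σ_σ |sgn σ|)² = (n!)²`
    have h1 : (∑ t : Fin k, (Matrix.of fun i j => L (e t) i j ^ 2).permanent) = (k : ℝ) := by
      simp [hper]
    have h2 : (∑ σ : Perm (Fin n), |∑ t : Fin k, ∏ i, L (e t) (σ i) i|) = (k : ℝ) := by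
      simp_rw [hF, abs_sign_cast]
      simp [hk]
    rw [h1, h2, hkfac]
    ring
  · -- (iii) equality term by term
    intro t
    refine ⟨by rw [hdet]; exact one_ne_zero, ?_⟩
    rw [hper, hdet, hkfac]
    ring

end Summit.ValiantsHypothesis.ValiantsHypothesis.Theorems.SliceSignRank.SrkNotQP
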